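import Summits.CriticalPhenomena.CardyFormulaZ2.Theorems.CardyBondTriangularBondTriangularCardyKiteDarts
import Literature.Probability.Percolation.TriCollarLocalConn
import HarnessLib

/-!
# Route CardyBondTriangular · crux `BondTriangularCardy` · line `birth`: the kite-interface toolkit, II — colours

Helper of the stub `stub_clDuality` (and of `stub_blueArm`). Two things:

* **The kite colours of a Chayes–Lei state.** `cornerY st k` is the colour of the corner
  `leftFaceDir x k` of a hexagon in state `st` (`Y`: all yellow; `B`: none; the admissible split
  `split j`: the three consecutive corners `2j - 1, 2j, 2j + 1`, centred at its yellow pole, the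
  up-corner `upCorner x j = leftFaceDir x (2j)`; Chayes–Lei, Rev. Math. Phys. 19 (2007) §2.1,
  Fig. 2) — `yellowAt_leftFaceDir_iff`. Consequences: the centre rule of file I holds
  (`cornerY_centre`), and a hexagon yellow at an up-corner is yellow at the two neighbouring
  corners (`cornerY_add_one_of_even`, `cornerY_add_five_of_even`), which is what excludes the
  "diagonal" pattern at an edge midpoint.
* **The kite colouring of a configuration on a 4-marked discrete domain** `D` (Bollobás–Riordan,
  *Percolation* (2006), Ch. 7, proof of Lemma 5 p. 170, with the outside coloured per boundary
  DART as in the tree's `TriDiscInterface.lean`): an inside kite `(x, k)`, `x ∈ G`, has the colour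
  of its corner in `σ x`; an outside kite is seen through the boundary dart `kdart G x k` (from
  the next hexagon of its corner if inside, else from the one after) and gets the colour
  `bcolOf` of the stretch of that dart (`A₀⁺, A₂⁺` yellow, `A₁⁺, A₃⁺` blue) — `kc D σ`, with the
  stretch index `ksidx`. Boundary bookkeeping: the two outside kites at a boundary edge agree
  (`ksidx_add_five`), the view of an outside kite from any inside hexagon of its corner is the
  same (`ksidx_eq_of_mem`), and at a corner with one inside hexagon the two outside kites differ
  in colour only at a mark (`corner_transition`).

References: Bollobás–Riordan 2006 Ch. 7 Lemma 5 pp. 169–171; Chayes–Lei 2007 §2.1.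
-/

namespace Summit.CriticalPhenomena.CardyFormulaZ2.Theorems.BondTriangularCardyLine.Kite

open Literature.Probability.Percolation Literature.Probability.LatticeModels
open RemovableAt (hexFaceVertices_leftFaceDir)

/-! ### The vertices of a corner

(`hexFaceVertices (leftFaceDir x k) = {x, x + triDir k, x + triDir (k + 1)}` is
`RemovableAt.hexFaceVertices_leftFaceDir` of `TriDiscShelling.lean`, and `x` belongs to it by
`mem_hexFaceVertices_leftFaceDir_self` of `TriCollarLocalConn.lean`.) -/

/-- The neighbour across the edge `k` is a vertex of the corner `k`. -/
theorem add_triDir_mem_leftFaceDir (x : Site 2) (k : Fin 6) : x + triDir k ∈ hexFaceVertices (leftFaceDir x k) := by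
  rw [hexFaceVertices_leftFaceDir]; simp

/-- The third hexagon at the corner `k`. -/
theorem add_triDir_succ_mem_leftFaceDir (x : Site 2) (k : Fin 6) :
    x + triDir (k + 1) ∈ hexFaceVertices (leftFaceDir x k) := by
  rw [hexFaceVertices_leftFaceDir]; simp

/-- Membership in a corner, unfolded. -/
theorem mem_leftFaceDir_iff {x z : Site 2} {k : Fin 6} :
    z ∈ hexFaceVertices (leftFaceDir x k) ↔ z = x ∨ z = x + triDir k ∨ z = x + triDir (k + 1) := by
  rw [hexFaceVertices_leftFaceDir]; simp

/-! ### The corners of a hexagon as up- and down-corners -/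

/-- The six corners `leftFaceDir x k` are, anticlockwise from `30°`: `upCorner x 0`,
`downCorner x 2`, `upCorner x 1`, `downCorner x 0`, `upCorner x 2`, `downCorner x 1`. -/
theorem leftFaceDir_eq_corner (x : Site 2) (k : Fin 6) :
    leftFaceDir x k = (![upCorner x 0, downCorner x 2, upCorner x 1, downCorner x 0, upCorner x 2, downCorner x 1] :
      Fin 6 → HexVertex) k := by
  fin_cases k <;> simp [leftFaceDir, upCorner, downCorner, triUnit, sub_eq_add_neg, add_assoc, add_comm, add_left_comm]

/-! ### The kite colours of a Chayes–Lei state -/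

/-- **The colour of the `k`-th corner of a hexagon in state `st`** (`true` = yellow): all / none /
the three consecutive corners `2j - 1, 2j, 2j + 1` for `Y` / `B` / `split j`. -/
def cornerY : CLHexState → Fin 6 → Bool
  | .Y, _ => true
  | .B, _ => false
  | .split j, k => (![![true, true, false, false, false, true], ![false, true, true, true, false, false],
      ![false, false, false, true, true, true]] : Fin 3 → Fin 6 → Bool) j k

/-- **`cornerY` is the corner colouring `yellowAt` of `ChayesLeiHex.lean`.** -/
theorem yellowAt_leftFaceDir_iff (st : CLHexState) (x : Site 2) (k : Fin 6) :
    st.yellowAt x (leftFaceDir x k) ↔ cornerY st k = true := by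
  rcases st with _ | _ | j
  · simp [cornerY]
  · simp [cornerY]
  · rw [leftFaceDir_eq_corner]
    fin_cases j <;> fin_cases k <;> simp [cornerY]

/-- `cornerY` as a `decide`. -/
theorem decide_yellowAt_leftFaceDir (st : CLHexState) (x : Site 2) (k : Fin 6) :
    decide (st.yellowAt x (leftFaceDir x k)) = cornerY st k := by
  by_cases h : st.yellowAt x (leftFaceDir x k)
  · rw [decide_eq_true h]; exact ((yellowAt_leftFaceDir_iff st x k).1 h).symm
  · rw [decide_eq_false h]
    have h' : cornerY st k ≠ true := fun h' => h ((yellowAt_leftFaceDir_iff st x k).2 h')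
    exact (by simpa using h' : cornerY st k = false).symm

/-- **The centre rule** for admissible states: a yellow corner preceded (clockwise) by a blue one
starts the yellow half of a split hexagon. -/
theorem cornerY_centre (st : CLHexState) (k : Fin 6) (h1 : cornerY st k = true) (h2 : cornerY st (k + 5) = false) :
    cornerY st (k + 1) = true ∧ cornerY st (k + 2) = true ∧ cornerY st (k + 3) = false ∧ cornerY st (k + 4) = false := by
  rcases st with _ | _ | j
  · simp [cornerY] at h2
  · simp [cornerY] at h1
  · revert h1 h2
    fin_cases j <;> fin_cases k <;> simp [cornerY]

/-- **Yellow at an up-corner (`k` even) forces yellow at the next corner** … -/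
theorem cornerY_add_one_of_even (st : CLHexState) {k : Fin 6} (hk : k.val % 2 = 0) (h : cornerY st k = true) :
    cornerY st (k + 1) = true := by
  rcases st with _ | _ | j
  · simp [cornerY]
  · simp [cornerY] at h
  · revert h hk
    fin_cases j <;> fin_cases k <;> simp [cornerY]

/-- … and at the previous corner (`yellowAt_downCorner_of_upCorner` in this indexing). -/
theorem cornerY_add_five_of_even (st : CLHexState) {k : Fin 6} (hk : k.val % 2 = 0) (h : cornerY st k = true) :
    cornerY st (k + 5) = true := by
  rcases st with _ | _ | j
  · simp [cornerY]
  · simp [cornerY] at h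
  · revert h hk
    fin_cases j <;> fin_cases k <;> simp [cornerY]

/-- A hexagon with a yellow corner is not pure blue. -/
theorem ne_B_of_cornerY {st : CLHexState} {k : Fin 6} (h : cornerY st k = true) : st ≠ CLHexState.B := by
  rintro rfl; simp [cornerY] at h

/-- A hexagon with a blue corner is not pure yellow. -/
theorem ne_Y_of_cornerY {st : CLHexState} {k : Fin 6} (h : cornerY st k = false) : st ≠ CLHexState.Y := by
  rintro rfl; simp [cornerY] at h

/-- **Registered anchor of this file** (`kite_yellowAt_neighbours_of_even`): a hexagon yellow at an
up-corner (`k` even) is yellow at the two neighbouring corners — the tree's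
`yellowAt_downCorner_of_upCorner` in the direction frame (Chayes–Lei 2007 §2.1: only the three
splits with yellow pole at a dual vertex occur). -/
theorem kite_yellowAt_neighbours_of_even : ∀ (st : Literature.Probability.Percolation.CLHexState) (x : Literature.Probability.LatticeModels.Site 2) (k : Fin 6), k.val % 2 = 0 → st.yellowAt x (Literature.Probability.Percolation.leftFaceDir x k) → st.yellowAt x (Literature.Probability.Percolation.leftFaceDir x (k + 1)) ∧ st.yellowAt x (Literature.Probability.Percolation.leftFaceDir x (k + 5)) := by
  intro st x k hk h
  rw [yellowAt_leftFaceDir_iff] at h ⊢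
  rw [yellowAt_leftFaceDir_iff]
  exact ⟨cornerY_add_one_of_even st hk h, cornerY_add_five_of_even st hk h⟩

/-! ### Faces by direction: conversions to the tree's `faceVertex` frame -/

/-- The vertex two after `x` in its corner `k` is the third hexagon `x + triDir (k + 1)`. -/
theorem faceVertex_leftFaceDir_succ_succ (x : Site 2) (k : Fin 6) :
    faceVertex (leftFaceDir x k) (leftFaceIdx k + 2) = x + triDir (k + 1) := by
  have h := triLeftApex_faceVertex (leftFaceDir x k) (leftFaceIdx k)
  rw [faceVertex_leftFaceDir_succ, faceVertex_leftFaceDir, triLeftApex_add_triDir] at h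
  exact h.symm

/-- The boundary successor of the dart `x → x + triDir k`: about the head if the third hexagon of
the left corner is inside, else about the tail. -/
theorem triBdrySucc_add_triDir (G : Finset (Site 2)) (x : Site 2) (k : Fin 6) :
    triBdrySucc G (x, x + triDir k) =
      if x + triDir (k + 1) ∈ G then (x + triDir (k + 1), x + triDir k) else (x, x + triDir (k + 1)) := by
  simp only [triBdrySucc, triLeftApex_add_triDir]

/-! ### The kite colouring of a configuration on a marked domain -/

/-- **The boundary dart through which the outside kite `(x, k)` is seen**: from the next hexagon
`x + triDir k` of its corner if that one is inside, else from the third one `x + triDir (k + 1)`.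
(Junk when neither is inside.) -/
def kdart (G : Finset (Site 2)) (x : Site 2) (k : Fin 6) : Site 2 × Site 2 :=
  if x + triDir k ∈ G then (x + triDir k, x) else (x + triDir (k + 1), x)

variable (D : TriMarkedDomain 4)

/-- The stretch of the boundary beyond which the outside kite `(x, k)` lies. -/
noncomputable def ksidx (x : Site 2) (k : Fin 6) : Fin 4 := D.stretchIdx (D.dpos (kdart D.verts x k))

/-- **The kite colouring of the configuration `σ` on the 4-marked domain `D`**: inside kites carry
the colour of their corner, outside kites the colour of the outer arc beyond their boundary dart
(`A₀⁺, A₂⁺` yellow, `A₁⁺, A₃⁺` blue: `bcolOf`). -/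
noncomputable def kc (σ : CLHexConfig) (x : Site 2) (k : Fin 6) : Bool :=
  if x ∈ D.verts then cornerY (σ x) k else TriMarkedDomain.bcolOf (ksidx D x k)

variable {D}

/-- The colour of an inside kite. -/
theorem kc_of_mem (σ : CLHexConfig) {x : Site 2} (hx : x ∈ D.verts) (k : Fin 6) : kc D σ x k = cornerY (σ x) k := by
  rw [kc, if_pos hx]

/-- The colour of an outside kite. -/
theorem kc_of_not_mem (σ : CLHexConfig) {x : Site 2} (hx : x ∉ D.verts) (k : Fin 6) :
    kc D σ x k = TriMarkedDomain.bcolOf (ksidx D x k) := by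
  rw [kc, if_neg hx]

/-- An inside yellow kite: the hexagon is yellow at that corner. -/
theorem yellowAt_of_kc {σ : CLHexConfig} {x : Site 2} (hx : x ∈ D.verts) {k : Fin 6} (h : kc D σ x k = true) :
    (σ x).yellowAt x (leftFaceDir x k) := by
  rw [kc_of_mem σ hx] at h; exact (yellowAt_leftFaceDir_iff _ _ _).2 h

/-- An inside blue kite: the hexagon is blue at that corner. -/
theorem not_yellowAt_of_kc {σ : CLHexConfig} {x : Site 2} (hx : x ∈ D.verts) {k : Fin 6} (h : kc D σ x k = false) :
    ¬ (σ x).yellowAt x (leftFaceDir x k) := by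
  rw [kc_of_mem σ hx] at h; rw [yellowAt_leftFaceDir_iff, h]; decide

/-- **The centre rule holds at every inside hexagon.** -/
theorem centreOK_of_mem (σ : CLHexConfig) {x : Site 2} (hx : x ∈ D.verts) : x ∈ centreOK (kc D σ) := by
  intro k h1 h2
  simp only [kc_of_mem σ hx] at h1 h2 ⊢
  exact cornerY_centre _ k h1 h2

/-! ### Boundary bookkeeping -/

/-- The dart of an outside kite whose next hexagon is inside. -/
theorem kdart_of_mem {x : Site 2} {k : Fin 6} (h : x + triDir k ∈ D.verts) : kdart D.verts x k = (x + triDir k, x) := by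
  rw [kdart, if_pos h]

/-- The dart of an outside kite whose next hexagon is outside. -/
theorem kdart_of_not_mem {x : Site 2} {k : Fin 6} (h : x + triDir k ∉ D.verts) :
    kdart D.verts x k = (x + triDir (k + 1), x) := by
  rw [kdart, if_neg h]

/-- The dart into an outside hexagon from an inside neighbour is a boundary dart. -/
theorem mem_triBdryDarts_of {x y : Site 2} (hy : y ∈ D.verts) (hx : x ∉ D.verts) (h : triGraph.Adj y x) :
    (y, x) ∈ triBdryDarts D.verts :=
  mem_triBdryDarts.2 ⟨hy, hx, h⟩

/-- **The two outside kites at a boundary edge agree**: for `x ∉ G` with `x + triDir k ∈ G`, the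
kites `(x, k + 5)` and `(x, k)` at the two ends of the edge `k` see the same stretch (they are
seen through the dart from `x + triDir k`, or through it and its boundary successor). -/
theorem ksidx_add_five {x : Site 2} {k : Fin 6} (hx : x ∉ D.verts) (hy : x + triDir k ∈ D.verts) :
    ksidx D x (k + 5) = ksidx D x k := by
  unfold ksidx
  rw [kdart_of_mem hy]
  by_cases hz : x + triDir (k + 5) ∈ D.verts
  · rw [kdart_of_mem hz]
    -- the successor of `x + triDir k → x` is `x + triDir (k + 5) → x`
    have hd : (x + triDir k, x) ∈ triBdryDarts D.verts :=
      mem_triBdryDarts_of hy hx (triGraph_adj_add_triDir x k).symm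
    have hsucc : triBdrySucc D.verts (x + triDir k, x) = (x + triDir (k + 5), x) := by
      have h := triBdrySucc_add_triDir D.verts (x + triDir k) (k + 3)
      rwa [triDir_add_three, add_neg_cancel_right, show k + 3 + 1 = k + 4 by rw [add_assoc]; rfl,
        add_triDir_add_triDir_add_four, if_pos hz] at h
    have := D.bdryCol_dpos_succ_of_fst_ne hd (by
      rw [hsucc]
      intro h
      exact absurd (add_left_cancel h) (fun h' => by have := triDir_injective h'; omega))
    rw [hsucc] at this
    exact this
  · rw [kdart_of_not_mem hz, fin6_add_five_add_one]

/-- **Views agree**: the stretch seen by an outside kite is that of the dart from ANY inside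
hexagon of its corner. -/
theorem ksidx_eq_of_mem {x g : Site 2} {k : Fin 6} (hx : x ∉ D.verts) (hg : g ∈ D.verts)
    (hgk : g ∈ hexFaceVertices (leftFaceDir x k)) : ksidx D x k = D.stretchIdx (D.dpos (g, x)) := by
  unfold ksidx
  rcases mem_leftFaceDir_iff.1 hgk with rfl | rfl | rfl
  · exact absurd hg hx
  · rw [kdart_of_mem hg]
  · by_cases hy : x + triDir k ∈ D.verts
    · rw [kdart_of_mem hy]
      -- the successor of `x + triDir (k + 1) → x` is `x + triDir k → x`
      have hd : (x + triDir (k + 1), x) ∈ triBdryDarts D.verts :=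
        mem_triBdryDarts_of hg hx (by
          have := triGraph_adj_add_triDir (x + triDir (k + 1)) (k + 4)
          rwa [add_triDir_succ_add_triDir_add_four] at this)
      have hsucc : triBdrySucc D.verts (x + triDir (k + 1), x) = (x + triDir k, x) := by
        have h := triBdrySucc_add_triDir D.verts (x + triDir (k + 1)) (k + 4)
        rwa [add_triDir_succ_add_triDir_add_four, fin6_add_four_add_one, add_triDir_succ_add_triDir_add_five,
          if_pos hy] at h
      have := D.bdryCol_dpos_succ_of_fst_ne hd (by
        rw [hsucc]
        intro h
        exact absurd (add_left_cancel h) (fun h' => by have := triDir_injective h'; omega))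
      rw [hsucc] at this
      exact this
    · rw [kdart_of_not_mem hy]

/-- The colour of an outside kite seen from an inside hexagon of its corner. -/
theorem kc_eq_bdryCol_of_mem (σ : CLHexConfig) {x g : Site 2} {k : Fin 6} (hx : x ∉ D.verts) (hg : g ∈ D.verts)
    (hgk : g ∈ hexFaceVertices (leftFaceDir x k)) : kc D σ x k = D.bdryCol (D.dpos (g, x)) := by
  rw [kc_of_not_mem σ hx, ksidx_eq_of_mem hx hg hgk]; rfl

/-- **The two outside kites at a boundary edge have the same colour.** -/
theorem kc_add_five {σ : CLHexConfig} {x : Site 2} {k : Fin 6} (hx : x ∉ D.verts) (hy : x + triDir k ∈ D.verts) :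
    kc D σ x (k + 5) = kc D σ x k := by
  rw [kc_of_not_mem σ hx, kc_of_not_mem σ hx, ksidx_add_five hx hy]

/-- **Transition at a corner** with one inside hexagon `g` and two outside ones `g + triDir k`,
`g + triDir (k + 1)`: if the two outside kites differ in colour, `g` is a marked site, the dart
`g → g + triDir k` is the last of the stretch `i - 1` and `g → g + triDir (k + 1)` the first of
the stretch `i` (the tree's `TriMarkedDomain.transition`, in the direction frame). -/
theorem corner_transition {g : Site 2} {k : Fin 6} (hg : g ∈ D.verts) (ha : g + triDir k ∉ D.verts)
    (hb : g + triDir (k + 1) ∉ D.verts)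
    (hne : D.bdryCol (D.dpos (g, g + triDir k)) ≠ D.bdryCol (D.dpos (g, g + triDir (k + 1)))) :
    ∃ i : Fin 4, g = D.markSite i ∧ D.stretchIdx (D.dpos (g, g + triDir k)) = i - 1 ∧
      D.stretchIdx (D.dpos (g, g + triDir (k + 1))) = i := by
  have h0 := faceVertex_leftFaceDir g k
  have h1 := faceVertex_leftFaceDir_succ g k
  have h2 := faceVertex_leftFaceDir_succ_succ g k
  have := D.transition (F := leftFaceDir g k) (v := leftFaceIdx k) (by rw [h0]; exact hg) (by rw [h1]; exact ha)
    (by rw [h2]; exact hb) (by rw [h0, h1, h2]; exact hne)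
  rwa [h0, h1, h2] at this

/-- At a corner with one inside hexagon and no mark, the two outside kites see the same stretch. -/
theorem stretchIdx_corner_eq {g : Site 2} {k : Fin 6} (hg : g ∈ D.verts) (ha : g + triDir k ∉ D.verts)
    (hb : g + triDir (k + 1) ∉ D.verts)
    (heq : D.bdryCol (D.dpos (g, g + triDir k)) = D.bdryCol (D.dpos (g, g + triDir (k + 1)))) :
    D.stretchIdx (D.dpos (g, g + triDir k)) = D.stretchIdx (D.dpos (g, g + triDir (k + 1))) := by
  have hd : (g, g + triDir k) ∈ triBdryDarts D.verts := mem_triBdryDarts.2 ⟨hg, ha, triGraph_adj_add_triDir g k⟩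
  have hsucc : triBdrySucc D.verts (g, g + triDir k) = (g, g + triDir (k + 1)) := by
    rw [triBdrySucc_add_triDir, if_neg hb]
  have := D.stretchIdx_dpos_succ_of_bdryCol_eq hd (by rw [hsucc]; exact heq.symm)
  rw [hsucc] at this
  exact this.symm

/-- The outside kites of the two outside hexagons at such a corner, as darts from `g`. -/
theorem ksidx_corner_fst (g : Site 2) {k : Fin 6} (hb : g + triDir (k + 1) ∉ D.verts) :
    ksidx D (g + triDir k) (k + 2) = D.stretchIdx (D.dpos (g, g + triDir k)) := by
  unfold ksidx
  rw [kdart_of_not_mem (by rwa [add_triDir_add_triDir_add_two]), fin6_add_two_add_one, triDir_add_three, add_neg_cancel_right]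

/-- … and for the third hexagon. -/
theorem ksidx_corner_snd {g : Site 2} (k : Fin 6) (hg : g ∈ D.verts) :
    ksidx D (g + triDir (k + 1)) (k + 4) = D.stretchIdx (D.dpos (g, g + triDir (k + 1))) := by
  unfold ksidx
  rw [kdart_of_mem (by rwa [add_triDir_succ_add_triDir_add_four]), add_triDir_succ_add_triDir_add_four]

end Summit.CriticalPhenomena.CardyFormulaZ2.Theorems.BondTriangularCardyLine.Kite
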